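import Mathlib
import Summits.ResolutionOfSingularities.ResolutionOfSingularities.Theses.RadicialJung
import Summits.ResolutionOfSingularities.ResolutionOfSingularities.Theorems.RadicialJungCleanModelsZeroDimValuations
import Summits.ResolutionOfSingularities.ResolutionOfSingularities.Theorems.RadicialJungCleanModelsCleanLUGenerises
import Summits.ResolutionOfSingularities.ResolutionOfSingularities.Theorems.RadicialJungCleanModelsLineRepresentativeTwist
import Literature.AlgebraicGeometry.Resolution.LocalBlowup
import Literature.AlgebraicGeometry.Resolution.AffineDomainEquidim
import HarnessLib

/-!
# Route `RadicialJung`, crux `CleanModels` (stmt-ResolutionOfSingularities-15917), skeleton `Cruxes/CleanModels/Lines/Sketch.lean` rev 35: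
# the support item `CleanAlongValuation4` (stmt-ResolutionOfSingularities-18006) IS the zero-dimensional local input of the skeleton,
# graded by the dimension of the centre — clean LU along ONE arbitrary valuation from clean LU at CLOSED points, over all ground fields

Explicit-unit seat `decomp-res-hand-2` g7 (share = stubs 5–7, strategy «structural: reduce to the most general landed lemma, then
specialise»).  OURS, def-free; nothing here proves resolution of singularities in characteristic `p`.

The skeleton (and the landed graded assembly ✓ `GradedAssembly.cleanModels_of_cleanLUZeroDim_of_cleanTwoModelPatching_allDim`) consumes
its local input only in the shape `CleanLUZeroDim_d`: clean local uniformization of the `K^p`-line of `g₀` at ZERO-DIMENSIONAL valuation rings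
(`hzd`: every centre above the model is a closed point) whose centre on a finitely generated model `A` with `Frac A = K`, `dim A ≤ d`, is REGULAR
of dimension `d` — i.e. at closed points of `d`-folds.  The route's support item `Theses.RadicialJung.CleanAlongValuation4` (stmt-18006, «first
lemma of the attack on CleanModels») asks the same conclusion along ONE ARBITRARY valuation ring `O ⊇ A₀` (any rank, any residue field, `K` of any
transcendence degree over `k`) whose centre is regular of dimension `≤ 4`.  This file proves the general DEF-FREE reduction

* `cleanAlongValuation_of_cleanLUZeroDim` — for every `N`: «`CleanLUZeroDim_d` for all `d ≤ N`, over ALL ground fields» ⟹ the body of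
  `CleanAlongValuation4` with `4` replaced by `N`;

and specialises it BY NAME:

* `cleanAlongValuation4_of_cleanLUZeroDim` — `(∀ d ≤ 4, CleanLUZeroDim_d) → Theses.RadicialJung.CleanAlongValuation4`.

Proof (three classical moves, all in the currency of `Literature/…/Resolution/LocalBlowup.lean`).  Let `R₀ = (A₀)_{𝔪_O ∩ A₀}` (`locAtCentre`),
regular of dimension `d ≤ N`, a non-closed point in general.  (1) FIELD OF CONSTANTS INSIDE THE CENTRE (`exists_intermediateField_le_locAtCentre`,
Zorn): a maximal intermediate field `k ⊆ k' ⊆ K` with `k' ⊆ R₀`; maximality forces every `x ∈ R₀` to satisfy a non-zero polynomial over `k'`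
modulo `𝔪_{R₀}` (else `k'(x) ⊆ R₀`).  Hence the `k'`-model `A₀' = k'[A₀] ⊆ R₀` has the SAME local ring `R₀` at the centre of `O`, and that centre is
now a MAXIMAL ideal (`isMaximal_subringCentre_of_forall_aeval`: `A₀'/𝔭` is a domain algebraic over `k'`), so `dim A₀' = dim R₀ = d` (affine domains
are equidimensional, ✓ `ringKrullDim_localization_atPrime_eq_of_isMaximal`).  (2) ZERO-DIMENSIONAL REFINEMENT (✓ `exists_zeroDim_refinement`):
`A₀' ⊆ O₀ ≤ O` with all centres above `A₀'` closed; since the centre of `O` on `A₀'` is already maximal, `O₀` and `O` have the same centre on `A₀'`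
and `(A₀')_{𝔪_{O₀} ∩ A₀'} = R₀` (`locAtCentre_congr_of_valuation_eq_one_iff`).  Apply `CleanLUZeroDim_d` over `k'` at `O₀`.  (3) GENERISE AND DESCEND:
regularity and loose cleanness generise from the centre of `O₀` to the centre of `O` up to a twist `e^p x^α − d^p` (✓ `looseClean_generises_of_le`,
✓ `nonTrivRep_twist`), and the `k'`-model `A' = k'[G']` is replaced by the `k`-model `A = k[G₀ ∪ G']`, which has the same local ring at the centre of
`O` because `k' ⊆ R₀ ⊆ A_{𝔪_O ∩ A}`.

Census consequence (with the companion file `…CleanAlongValuation4Census.lean`): stmt-18006 ⟺ `CleanLUZeroDim_{≤ 4}`; it is therefore NOT a «first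
lemma» but the whole local half of the crux up to dimension `4` (at `d = 3`: print + the class-(B) research residual `stub_cleanLU3DefectNonDiscrete`;
at `d = 4`: ELU₄ at rank-one non-Abhyankar places + class (B)₄, hand-2 g6).  Structural bookkeeping, counted 0.
-/

noncomputable section

set_option linter.dupNamespace false -- mandated namespace of this single-conjunct summit

open IsLocalRing Polynomial
open Literature.AlgebraicGeometry.Resolution

namespace Summit.ResolutionOfSingularities.ResolutionOfSingularities.Theorems.RadicialJung.CleanModels

/-! ## §1 Three generic lemmas -/

/-- `locAtCentre B O` only depends on which elements of `B` are units of `O`: two valuation rings with the same units on `B` give the same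
local ring `B_{𝔪 ∩ B} ⊆ K`. [folklore] -/
theorem locAtCentre_congr_of_valuation_eq_one_iff {K : Type*} [Field K] {B : Subring K} {O O' : ValuationSubring K}
    (h : ∀ z ∈ B, O.valuation z = 1 ↔ O'.valuation z = 1) : locAtCentre B O = locAtCentre B O' := by
  ext x
  simp only [mem_locAtCentre_iff]
  constructor
  · rintro ⟨y, hy, z, hz, hv, hx⟩
    exact ⟨y, hy, z, hz, (h z hz).mp hv, hx⟩
  · rintro ⟨y, hy, z, hz, hv, hx⟩
    exact ⟨y, hy, z, hz, (h z hz).mpr hv, hx⟩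

/-- **The centre is a closed point when the model is residually algebraic over the constants**: if every element of a `k'`-subalgebra
`R ⊆ O` satisfies a non-zero polynomial over `k'` modulo `𝔪_O`, then the centre `𝔪_O ∩ R` is a MAXIMAL ideal of `R` (the quotient is a domain
algebraic over the field `k'`).  (Variant of ✓ `isMaximal_centre_of_zeroDim'` with the hypothesis asked on `R` only.) [folklore] -/
theorem isMaximal_subringCentre_of_forall_aeval {k' K : Type} [Field k'] [Field K] [Algebra k' K] (O : ValuationSubring K)
    (R : Subalgebra k' K) (hRO : R.toSubring ≤ O.toSubring)
    (h : ∀ x ∈ R, ∃ g : k'[X], g ≠ 0 ∧ O.valuation (aeval x g) < 1) :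
    (subringCentre R.toSubring O hRO).IsMaximal := by
  classical
  set 𝔭 : Ideal R.toSubring := subringCentre R.toSubring O hRO with h𝔭
  letI : Algebra k' R.toSubring := R.algebra
  haveI : IsDomain (R.toSubring ⧸ 𝔭) := Ideal.Quotient.isDomain 𝔭
  have hint : Algebra.IsIntegral k' (R.toSubring ⧸ 𝔭) := by
    refine ⟨fun z => ?_⟩
    obtain ⟨r, rfl⟩ := Ideal.Quotient.mk_surjective z
    obtain ⟨f, hf0, hf⟩ := h (r : K) r.2
    refine IsAlgebraic.isIntegral ⟨f, hf0, ?_⟩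
    have h1 : aeval (Ideal.Quotient.mk 𝔭 r) f = Ideal.Quotient.mkₐ k' 𝔭 (aeval r f) := by
      rw [← aeval_algHom_apply]
      rfl
    rw [h1, Ideal.Quotient.mkₐ_eq_mk, Ideal.Quotient.eq_zero_iff_mem, h𝔭, mem_subringCentre_iff]
    have h2 : ((aeval r f : R.toSubring) : K) = aeval (r : K) f := (Subalgebra.aeval_coe R r f).symm
    rw [h2]
    exact hf
  have hfield : IsField (R.toSubring ⧸ 𝔭) := by
    haveI := hint
    exact (Algebra.IsIntegral.isField_iff_isField (R := k') (S := R.toSubring ⧸ 𝔭)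
      (FaithfulSMul.algebraMap_injective k' _)).mp (Field.toIsField k')
  exact Ideal.Quotient.maximal_of_isField 𝔭 hfield

/-- **A field of constants inside the centre** (Zorn).  Let `O` be a valuation ring of `K ⊇ k`, `B ⊆ O` a subring with `k ⊆ B_{𝔪_O ∩ B}`.  There is
an intermediate field `k ⊆ k' ⊆ K` contained in the local ring `B_{𝔪_O ∩ B}` such that every `x ∈ B_{𝔪_O ∩ B}` satisfies a non-zero polynomial over
`k'` modulo `𝔪_O` — the residue field of the centre is algebraic over (the image of) `k'`.  Take `k'` maximal inside `B_{𝔪_O ∩ B}`: if `x` violated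
the conclusion, every non-zero polynomial in `x` would be a unit, so `k'(x) ⊆ B_{𝔪_O ∩ B}` and `x ∈ k'`, absurd (`X - x`). [folklore] -/
theorem exists_intermediateField_le_locAtCentre {k K : Type} [Field k] [Field K] [Algebra k K] (O : ValuationSubring K)
    (B : Subring K) (hB : B ≤ O.toSubring) (hk : ∀ c : k, algebraMap k K c ∈ locAtCentre B O) :
    ∃ k' : IntermediateField k K, (∀ x : K, x ∈ k' → x ∈ locAtCentre B O) ∧
      ∀ x ∈ locAtCentre B O, ∃ g : Polynomial k', g ≠ 0 ∧ O.valuation (aeval x g) < 1 := by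
  classical
  set L := locAtCentre B O with hL
  have hLO : L ≤ O.toSubring := locAtCentre_le hB
  let S : Set (IntermediateField k K) := {F | ∀ x : K, x ∈ F → x ∈ L}
  have hbot : (⊥ : IntermediateField k K) ∈ S := by
    intro x hx
    obtain ⟨c, rfl⟩ := IntermediateField.mem_bot.mp hx
    exact hk c
  have hchain : ∀ c ⊆ S, IsChain (· ≤ ·) c → ∀ y ∈ c, ∃ ub ∈ S, ∀ z ∈ c, z ≤ ub := by
    intro c hcS hc y hy
    haveI : Nonempty c := ⟨⟨y, hy⟩⟩
    have hdir : Directed (· ≤ ·) (fun F : c => (F : IntermediateField k K)) := hc.directedOn.directed_val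
    refine ⟨⨆ F : c, (F : IntermediateField k K), ?_, fun z hz => le_iSup (fun F : c => (F : IntermediateField k K)) ⟨z, hz⟩⟩
    intro x hx
    have hx' : x ∈ ((⨆ F : c, (F : IntermediateField k K) : IntermediateField k K) : Set K) := hx
    rw [IntermediateField.coe_iSup_of_directed hdir, Set.mem_iUnion] at hx'
    obtain ⟨F, hF⟩ := hx'
    exact hcS F.2 x hF
  obtain ⟨k', -, hk'⟩ := zorn_le_nonempty₀ S hchain ⊥ hbot
  have hk'S : ∀ x : K, x ∈ k' → x ∈ L := hk'.prop
  refine ⟨k', hk'S, fun x hx => ?_⟩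
  by_contra hcon
  push Not at hcon
  -- every non-zero polynomial in `x` is a unit of `O`
  let Lk : Subalgebra k' K :=
    { L with algebraMap_mem' := fun c => hk'S c c.2 }
  have hmemL : ∀ g : Polynomial k', aeval x g ∈ L := fun g => by
    have : aeval x g = ((aeval (⟨x, hx⟩ : Lk) g : Lk) : K) := (Subalgebra.aeval_coe Lk ⟨x, hx⟩ g)
    rw [this]
    exact (aeval (⟨x, hx⟩ : Lk) g).2
  have hval : ∀ g : Polynomial k', g ≠ 0 → O.valuation (aeval x g) = 1 := fun g hg =>
    le_antisymm ((O.valuation_le_one_iff _).mpr (hLO (hmemL g))) (hcon g hg)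
  -- hence `k'(x) ⊆ L`
  let F : IntermediateField k K := (IntermediateField.adjoin k' {x}).restrictScalars k
  have hFS : F ∈ S := by
    intro y hy
    change y ∈ IntermediateField.adjoin k' {x} at hy
    rw [IntermediateField.mem_adjoin_simple_iff] at hy
    obtain ⟨r, s, rfl⟩ := hy
    by_cases hs : s = 0
    · rw [hs, map_zero, div_zero]
      exact L.zero_mem
    · rw [div_eq_mul_inv]
      exact L.mul_mem (hmemL r) (inv_mem_locAtCentre (hmemL s) (hval s hs))
  have hle : k' ≤ F := by
    intro y hy
    change y ∈ IntermediateField.adjoin k' {x}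
    exact (IntermediateField.adjoin k' {x}).algebraMap_mem ⟨y, hy⟩
  have hxF : x ∈ F := by
    change x ∈ IntermediateField.adjoin k' {x}
    exact IntermediateField.mem_adjoin_simple_self k' x
  have hFk' : F = k' := hk'.eq_of_ge hFS hle
  have hxk' : x ∈ k' := hFk' ▸ hxF
  have h0 := hcon (X - C (⟨x, hxk'⟩ : k')) (X_sub_C_ne_zero _)
  have : aeval x (X - C (⟨x, hxk'⟩ : k')) = 0 := by
    rw [map_sub, aeval_X, aeval_C, sub_eq_zero]
    rfl
  rw [this, map_zero] at h0
  exact not_lt.mpr h0 zero_lt_one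

/-! ## §2 Clean LU along one valuation from clean LU at closed points, graded by the dimension of the centre -/

/-- **Clean local uniformization along ONE arbitrary valuation, at a regular centre of dimension `≤ N`, from clean local uniformization at
ZERO-DIMENSIONAL valuations with a `d`-dimensional regular centre for every `d ≤ N` (over all ground fields of characteristic `p`).**  The
hypothesis `hLU d` is VERBATIM the graded local input `CleanLUZeroDim_d` of ✓ `GradedAssembly.cleanModels_of_cleanLUZeroDim_of_cleanTwoModelPatching_allDim`
(at `d = 3` the statement of the skeleton node `cleanLU3_of_stubs`); the conclusion is the body of the support item
`Theses.RadicialJung.CleanAlongValuation4` with `4` replaced by `N`.  Proof: field of constants inside the centre (Zorn,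
`exists_intermediateField_le_locAtCentre`), the `k'`-model `k'[A₀]` with the same local ring and a CLOSED centre, zero-dimensional refinement
(✓ `exists_zeroDim_refinement`), `hLU d` over `k'`, generisation (✓ `looseClean_generises_of_le`, ✓ `nonTrivRep_twist`) and descent of the
constants (`k' ⊆ A_{𝔪_O ∩ A}`).  See the module docstring. [folklore] -/
theorem cleanAlongValuation_of_cleanLUZeroDim (N : ℕ)
    (hLU : ∀ d : ℕ, d ≤ N → ∀ (p : ℕ), p.Prime →
    ∀ (k : Type) [Field k] [CharP k p] (K : Type) [Field K] [Algebra k K]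
    (O : ValuationSubring K) (A : Subalgebra k K), A.toSubring ≤ O.toSubring → A.FG → IsFractionRing A K →
    ringKrullDim A ≤ (d : WithBot ℕ∞) → IsRegularLocalRing (locAtCentre A.toSubring O) →
    ringKrullDim (locAtCentre A.toSubring O) = (d : WithBot ℕ∞) →
    (∀ (T : Subring K) (hT : T ≤ O.toSubring), A.toSubring ≤ T → (subringCentre T O hT).IsMaximal) →
    ∀ g₀ : K, (∀ c : K, c ^ p ≠ g₀) →
    ∃ (A' : Subalgebra k K), A'.toSubring ≤ O.toSubring ∧ A ≤ A' ∧ A'.FG ∧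
    ∃ (_ : IsRegularLocalRing (locAtCentre A'.toSubring O)) (c : Fin p → K), (∃ j : Fin p, (j : ℕ) ≠ 0 ∧ c j ≠ 0) ∧
    ((∃ (d m : ℕ) (hmd : m ≤ d) (t : Fin d → ↥(locAtCentre A'.toSubring O)) (a : Fin m → ℕ) (u : ↥(locAtCentre A'.toSubring O)), IsUnit u ∧
    Ideal.span (Set.range t) = IsLocalRing.maximalIdeal ↥(locAtCentre A'.toSubring O) ∧
    ringKrullDim ↥(locAtCentre A'.toSubring O) = (d : WithBot ℕ∞) ∧ 0 < m ∧ (∀ i, ¬ p ∣ a i) ∧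
    (∑ j : Fin p, c j ^ p * g₀ ^ (j : ℕ)) = (u : K) * ∏ i : Fin m, ((t (Fin.castLE hmd i) : ↥(locAtCentre A'.toSubring O)) : K) ^ (a i)) ∨
    (∃ u : ↥(locAtCentre A'.toSubring O), IsUnit u ∧ (∑ j : Fin p, c j ^ p * g₀ ^ (j : ℕ)) = (u : K) ∧
    ∀ c' : ↥(locAtCentre A'.toSubring O), u - c' ^ p ∉ IsLocalRing.maximalIdeal ↥(locAtCentre A'.toSubring O)) ∨
    (∃ s c' : ↥(locAtCentre A'.toSubring O), (∑ j : Fin p, c j ^ p * g₀ ^ (j : ℕ)) = (s : K) ∧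
    s - c' ^ p ∈ IsLocalRing.maximalIdeal ↥(locAtCentre A'.toSubring O) ∧
    s - c' ^ p ∉ IsLocalRing.maximalIdeal ↥(locAtCentre A'.toSubring O) ^ 2))) :
    ∀ p : ℕ, p.Prime → ∀ (k K : Type) [Field k] [CharP k p] [Field K] [Algebra k K] (O : ValuationSubring K)
      (A₀ : Subalgebra k K) (h₀ : A₀.toSubring ≤ O.toSubring) (g : K), A₀.FG → IsFractionRing A₀ K → (∀ c : K, c ^ p ≠ g) →
      IsRegularLocalRing (locAtCentre A₀.toSubring O) →
      ringKrullDim (locAtCentre A₀.toSubring O) ≤ ((N : ℕ) : WithBot ℕ∞) →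
      ∃ (A : Subalgebra k K) (_h : A.toSubring ≤ O.toSubring) (_ : IsRegularLocalRing (locAtCentre A.toSubring O)),
        A₀ ≤ A ∧ A.FG ∧ ∃ c : Fin p → K, (∃ j : Fin p, (j : ℕ) ≠ 0 ∧ c j ≠ 0) ∧
        ((∃ (d m : ℕ) (hmd : m ≤ d) (t : Fin d → locAtCentre A.toSubring O) (a : Fin m → ℕ) (u : locAtCentre A.toSubring O),
            IsUnit u ∧ Ideal.span (Set.range t) = IsLocalRing.maximalIdeal (locAtCentre A.toSubring O) ∧
            ringKrullDim (locAtCentre A.toSubring O) = (d : WithBot ℕ∞) ∧ 0 < m ∧ (∀ i, ¬ p ∣ a i) ∧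
            (∑ j : Fin p, c j ^ p * g ^ (j : ℕ)) =
              (u : K) * ∏ i : Fin m, ((t (Fin.castLE hmd i) : locAtCentre A.toSubring O) : K) ^ (a i)) ∨
          (∃ u : locAtCentre A.toSubring O, IsUnit u ∧ (∑ j : Fin p, c j ^ p * g ^ (j : ℕ)) = (u : K) ∧
            ∀ c' : locAtCentre A.toSubring O, u - c' ^ p ∉ IsLocalRing.maximalIdeal (locAtCentre A.toSubring O)) ∨
          (∃ s c' : locAtCentre A.toSubring O, (∑ j : Fin p, c j ^ p * g ^ (j : ℕ)) = (s : K) ∧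
            s - c' ^ p ∈ IsLocalRing.maximalIdeal (locAtCentre A.toSubring O) ∧
            s - c' ^ p ∉ IsLocalRing.maximalIdeal (locAtCentre A.toSubring O) ^ 2)) := by
  intro p hp k K _ _ _ _ O A₀ h₀ g hA₀fg hfrac hg hreg hdimle
  classical
  haveI : Fact p.Prime := ⟨hp⟩
  haveI : CharP K p := charP_of_injective_algebraMap (algebraMap k K).injective p
  set R₀ : Subring K := locAtCentre A₀.toSubring O with hR₀def
  have hR₀O : R₀ ≤ O.toSubring := locAtCentre_le h₀
  haveI hreg₀ : IsRegularLocalRing R₀ := hreg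
  -- the dimension of the centre, a natural number `d ≤ N`
  obtain ⟨d, hdN, hd⟩ : ∃ d : ℕ, d ≤ N ∧ ringKrullDim R₀ = (d : WithBot ℕ∞) := by
    have h0 : (0 : WithBot ℕ∞) ≤ ringKrullDim R₀ := ringKrullDim_nonneg_of_nontrivial
    generalize ringKrullDim R₀ = x at h0 hdimle
    induction x using WithBot.recBotCoe with
    | bot => exact absurd h0 (by simp)
    | coe x =>
      induction x using ENat.recTopCoe with
      | top =>
        exfalso
        have h' : ((⊤ : ℕ∞) : WithBot ℕ∞) ≤ ((N : ℕ∞) : WithBot ℕ∞) := hdimle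
        exact (ENat.coe_ne_top N) (top_le_iff.mp (WithBot.coe_le_coe.mp h'))
      | coe d =>
        refine ⟨d, ?_, rfl⟩
        have h' : ((d : ℕ∞) : WithBot ℕ∞) ≤ ((N : ℕ∞) : WithBot ℕ∞) := hdimle
        exact_mod_cast h'
  -- (1) a field of constants `k'` inside the centre
  have hkR₀ : ∀ c : k, algebraMap k K c ∈ R₀ := fun c => le_locAtCentre _ O (A₀.algebraMap_mem c)
  obtain ⟨k', hk'R₀, hcrit⟩ := exists_intermediateField_le_locAtCentre O A₀.toSubring h₀ hkR₀
  haveI : CharP k' p := charP_of_injective_algebraMap (algebraMap k k').injective p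
  -- (2) the `k'`-model `A₀' = k'[A₀]`, inside `R₀`
  obtain ⟨G₀, hG₀⟩ := hA₀fg
  let A₀' : Subalgebra k' K := Algebra.adjoin k' (G₀ : Set K)
  have hG₀A₀ : ∀ x ∈ (G₀ : Set K), x ∈ A₀ := fun x hx => hG₀ ▸ Algebra.subset_adjoin hx
  have hA₀A₀' : ∀ x ∈ A₀, x ∈ A₀' := by
    intro x hx
    rw [← hG₀] at hx
    have hle : Algebra.adjoin k (G₀ : Set K) ≤ (Algebra.adjoin k' (G₀ : Set K)).restrictScalars k :=
      Algebra.adjoin_le fun y hy => (Algebra.subset_adjoin hy : y ∈ Algebra.adjoin k' (G₀ : Set K))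
    exact hle hx
  let R₀' : Subalgebra k' K := { R₀ with algebraMap_mem' := fun c => hk'R₀ c c.2 }
  have hA₀'R₀ : A₀'.toSubring ≤ R₀ := by
    have hle : A₀' ≤ R₀' := Algebra.adjoin_le fun y hy => (le_locAtCentre _ O (hG₀A₀ y hy) : y ∈ R₀)
    exact fun x hx => hle hx
  have hA₀'O : A₀'.toSubring ≤ O.toSubring := hA₀'R₀.trans hR₀O
  have hlocEq : locAtCentre A₀'.toSubring O = R₀ :=
    le_antisymm ((locAtCentre_mono O hA₀'R₀).trans (locAtCentre_locAtCentre A₀.toSubring O).le)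
      (locAtCentre_mono O fun x hx => hA₀A₀' x hx)
  -- the centre of `O` on `A₀'` is a maximal ideal
  have hP'max : (subringCentre A₀'.toSubring O hA₀'O).IsMaximal :=
    isMaximal_subringCentre_of_forall_aeval O A₀' hA₀'O fun x hx => hcrit x (hA₀'R₀ hx)
  -- (3) zero-dimensional refinement above `A₀'`; same centre on `A₀'`
  obtain ⟨O₀, hO₀O, hA₀'O₀, hzd⟩ := exists_zeroDim_refinement O A₀'.toSubring hA₀'O
  have hcen : ∀ z ∈ A₀'.toSubring, O₀.valuation z = 1 ↔ O.valuation z = 1 := by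
    intro z hz
    refine ⟨valuation_eq_one_of_le hO₀O, fun hz1 => ?_⟩
    by_contra hne
    have hlt : O₀.valuation z < 1 := lt_of_le_of_ne ((O₀.valuation_le_one_iff z).mpr (hA₀'O₀ hz)) hne
    -- `z` lies in the centre of `O₀`, a prime containing the maximal centre of `O`
    have hle : subringCentre A₀'.toSubring O hA₀'O ≤ subringCentre A₀'.toSubring O₀ hA₀'O₀ := by
      intro w hw
      rw [mem_subringCentre_iff] at hw ⊢
      rcases ((O₀.valuation_le_one_iff (w : K)).mpr (hA₀'O₀ w.2)).lt_or_eq with h | h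
      · exact h
      · exact absurd (valuation_eq_one_of_le hO₀O h) (ne_of_lt hw)
    have heq : subringCentre A₀'.toSubring O hA₀'O = subringCentre A₀'.toSubring O₀ hA₀'O₀ :=
      hP'max.eq_of_le (Ideal.IsPrime.ne_top inferInstance) hle
    have hzmem : (⟨z, hz⟩ : A₀'.toSubring) ∈ subringCentre A₀'.toSubring O₀ hA₀'O₀ :=
      (mem_subringCentre_iff hA₀'O₀ _).mpr hlt
    rw [← heq, mem_subringCentre_iff] at hzmem
    exact (ne_of_lt hzmem) hz1
  have hlocEq₀ : locAtCentre A₀'.toSubring O₀ = locAtCentre A₀'.toSubring O :=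
    locAtCentre_congr_of_valuation_eq_one_iff hcen
  -- (4) the hypotheses of `hLU d` over `k'`
  have hreg' : IsRegularLocalRing (locAtCentre A₀'.toSubring O₀) := by
    rw [hlocEq₀, hlocEq]; exact hreg₀
  have hdim' : ringKrullDim (locAtCentre A₀'.toSubring O₀) = (d : WithBot ℕ∞) := by
    rw [hlocEq₀, hlocEq]; exact hd
  haveI hfracI : IsFractionRing A₀ K := hfrac
  have hfrac' : IsFractionRing A₀' K := by
    refine IsFractionRing.of_field A₀' K fun z => ?_
    obtain ⟨a, b, -, hab⟩ := IsFractionRing.div_surjective (A := A₀) z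
    exact ⟨⟨a, hA₀A₀' a a.2⟩, ⟨b, hA₀A₀' b b.2⟩, hab.symm⟩
  have hA₀'fg : A₀'.FG := ⟨G₀, rfl⟩
  have hdimA₀' : ringKrullDim A₀' ≤ (d : WithBot ℕ∞) := by
    letI : Algebra k' A₀'.toSubring := A₀'.algebra
    haveI : Algebra.FiniteType k' A₀'.toSubring := A₀'.fg_iff_finiteType.mp hA₀'fg
    haveI := hP'max
    have h1 : ringKrullDim (Localization.AtPrime (subringCentre A₀'.toSubring O hA₀'O)) = ringKrullDim A₀'.toSubring :=
      ringKrullDim_localization_atPrime_eq_of_isMaximal k' _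
    have h2 : ringKrullDim (Localization.AtPrime (subringCentre A₀'.toSubring O hA₀'O)) =
        ringKrullDim (locAtCentre A₀'.toSubring O) :=
      ringKrullDim_eq_of_ringEquiv (locAtCentreEquiv hA₀'O).toRingEquiv
    have h3 : ringKrullDim A₀'.toSubring = (d : WithBot ℕ∞) := by
      rw [← h1, h2, hlocEq, hd]
    exact (le_of_eq h3 : ringKrullDim A₀'.toSubring ≤ (d : WithBot ℕ∞))
  -- (5) clean LU at the refined, zero-dimensional valuation, over `k'`
  obtain ⟨A', hA'O₀, hA₀'A', hA'fg, hregA', c, hc, hform⟩ :=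
    hLU d hdN p hp k' K O₀ A₀' hA₀'O₀ hA₀'fg hfrac' hdimA₀' hreg' hdim' hzd g hg
  -- (6) generise to the centre of `O`
  have hAS : ∀ x ∈ A₀, x ∈ locAtCentre A'.toSubring O₀ :=
    fun x hx => le_locAtCentre A'.toSubring O₀ (hA₀'A' (hA₀A₀' x hx))
  have hfracA' : IsFractionRing (locAtCentre A'.toSubring O₀) K := by
    refine IsFractionRing.of_field (locAtCentre A'.toSubring O₀) K fun z => ?_
    obtain ⟨a, b, -, hab⟩ := IsFractionRing.div_surjective (A := A₀) z
    exact ⟨⟨a, hAS a a.2⟩, ⟨b, hAS b b.2⟩, hab.symm⟩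
  obtain ⟨hregA'O, α, e, dd, hα, he, hform'⟩ :=
    looseClean_generises_of_le p hO₀O A'.toSubring hA'O₀ hregA' hfracA' (∑ j : Fin p, c j ^ p * g ^ (j : ℕ)) hform
  obtain ⟨c', hc', hsum⟩ := nonTrivRep_twist p g (fun b => hg b) c hc α hα e dd he
  -- (7) descend the constants: `A = k[G₀ ∪ G']` has the same local ring at the centre of `O` as `A' = k'[G']`
  obtain ⟨G', hG'⟩ := hA'fg
  let A : Subalgebra k K := Algebra.adjoin k ((G₀ : Set K) ∪ (G' : Set K))
  have hG'A' : ∀ y ∈ (G' : Set K), y ∈ A' := fun y hy => hG' ▸ Algebra.subset_adjoin hy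
  have hAA' : ∀ x ∈ A, x ∈ A' := by
    intro x hx
    have hle : A ≤ A'.restrictScalars k := by
      refine Algebra.adjoin_le ?_
      rintro y (hy | hy)
      · exact (hA₀'A' (hA₀A₀' y (hG₀A₀ y hy)) : y ∈ A')
      · exact (hG'A' y hy : y ∈ A')
    exact hle hx
  have hAO : A.toSubring ≤ O.toSubring := fun x hx => hO₀O (hA'O₀ (hAA' x hx))
  have hA₀A : A₀ ≤ A := by
    rw [← hG₀]
    exact Algebra.adjoin_mono Set.subset_union_left
  have hA'cl : A'.toSubring = Subring.closure (Set.range (algebraMap k' K) ∪ (G' : Set K)) := by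
    rw [← hG']
    exact Algebra.adjoin_eq_ring_closure _
  have hA'loc : A'.toSubring ≤ locAtCentre A.toSubring O := by
    rw [hA'cl, Subring.closure_le]
    rintro y (⟨c, rfl⟩ | hy)
    · exact locAtCentre_mono O (fun x hx => hA₀A hx) (hk'R₀ c c.2)
    · exact le_locAtCentre A.toSubring O (Algebra.subset_adjoin (Or.inr hy))
  have hEq : locAtCentre A.toSubring O = locAtCentre A'.toSubring O :=
    le_antisymm (locAtCentre_mono O fun x hx => hAA' x hx)
      ((locAtCentre_mono O hA'loc).trans (locAtCentre_locAtCentre A.toSubring O).le)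
  refine ⟨A, hAO, ?_⟩
  rw [hEq]
  have hAfg : A.FG := ⟨G₀ ∪ G', by rw [Finset.coe_union]⟩
  refine ⟨hregA'O, hA₀A, hAfg, c', hc', ?_⟩
  rw [hsum]
  exact hform'

/-- **The support item `CleanAlongValuation4` (stmt-ResolutionOfSingularities-18006) BY NAME from the graded zero-dimensional local input of
the skeleton in dimensions `d ≤ 4`** — `cleanAlongValuation_of_cleanLUZeroDim` at `N = 4`.  Structural reduction only; `CleanLUZeroDim_3` is
print + the class-(B) residual `stub_cleanLU3DefectNonDiscrete`, `CleanLUZeroDim_4` is open (ELU₄ + class (B)₄), `CleanLUZeroDim_{≤ 2}` is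
classical (companion census file). [folklore] -/
theorem cleanAlongValuation4_of_cleanLUZeroDim
    (hLU : ∀ d : ℕ, d ≤ 4 → ∀ (p : ℕ), p.Prime →
    ∀ (k : Type) [Field k] [CharP k p] (K : Type) [Field K] [Algebra k K]
    (O : ValuationSubring K) (A : Subalgebra k K), A.toSubring ≤ O.toSubring → A.FG → IsFractionRing A K →
    ringKrullDim A ≤ (d : WithBot ℕ∞) → IsRegularLocalRing (locAtCentre A.toSubring O) →
    ringKrullDim (locAtCentre A.toSubring O) = (d : WithBot ℕ∞) →
    (∀ (T : Subring K) (hT : T ≤ O.toSubring), A.toSubring ≤ T → (subringCentre T O hT).IsMaximal) →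
    ∀ g₀ : K, (∀ c : K, c ^ p ≠ g₀) →
    ∃ (A' : Subalgebra k K), A'.toSubring ≤ O.toSubring ∧ A ≤ A' ∧ A'.FG ∧
    ∃ (_ : IsRegularLocalRing (locAtCentre A'.toSubring O)) (c : Fin p → K), (∃ j : Fin p, (j : ℕ) ≠ 0 ∧ c j ≠ 0) ∧
    ((∃ (d m : ℕ) (hmd : m ≤ d) (t : Fin d → ↥(locAtCentre A'.toSubring O)) (a : Fin m → ℕ) (u : ↥(locAtCentre A'.toSubring O)), IsUnit u ∧
    Ideal.span (Set.range t) = IsLocalRing.maximalIdeal ↥(locAtCentre A'.toSubring O) ∧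
    ringKrullDim ↥(locAtCentre A'.toSubring O) = (d : WithBot ℕ∞) ∧ 0 < m ∧ (∀ i, ¬ p ∣ a i) ∧
    (∑ j : Fin p, c j ^ p * g₀ ^ (j : ℕ)) = (u : K) * ∏ i : Fin m, ((t (Fin.castLE hmd i) : ↥(locAtCentre A'.toSubring O)) : K) ^ (a i)) ∨
    (∃ u : ↥(locAtCentre A'.toSubring O), IsUnit u ∧ (∑ j : Fin p, c j ^ p * g₀ ^ (j : ℕ)) = (u : K) ∧
    ∀ c' : ↥(locAtCentre A'.toSubring O), u - c' ^ p ∉ IsLocalRing.maximalIdeal ↥(locAtCentre A'.toSubring O)) ∨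
    (∃ s c' : ↥(locAtCentre A'.toSubring O), (∑ j : Fin p, c j ^ p * g₀ ^ (j : ℕ)) = (s : K) ∧
    s - c' ^ p ∈ IsLocalRing.maximalIdeal ↥(locAtCentre A'.toSubring O) ∧
    s - c' ^ p ∉ IsLocalRing.maximalIdeal ↥(locAtCentre A'.toSubring O) ^ 2))) :
    Summit.ResolutionOfSingularities.ResolutionOfSingularities.Theses.RadicialJung.CleanAlongValuation4 :=
  cleanAlongValuation_of_cleanLUZeroDim 4 hLU

end Summit.ResolutionOfSingularities.ResolutionOfSingularities.Theorems.RadicialJung.CleanModels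

end
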